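import Literature.Computability.AlgebraicComplexity.ConstituentStageUniverse
import Literature.Computability.AlgebraicComplexity.ConstituentStageTriples
import Literature.Computability.AlgebraicComplexity.HashedZeroOut
import HarnessLib

/-!
# The structure of the constituent stage: after hashing and the zero-outs of §6.3–§6.5 the input is a
direct sum of broken copies of `𝒯*` with holes of both types
(Vassilevska Williams–Xu–Xu–Zhou 2024, §6.2–§6.5) — proved

Topic `Literature/Computability/AlgebraicComplexity`.  This file instantiates the abstract hashed-stage
structure (`HashedZeroOut.lean`) with the data of one region of the constituent stage of Vassilevska
Williams–Xu–Xu–Zhou, *New bounds for matrix multiplication: from alpha to omega* (SODA 2024,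
arXiv:2307.07970), §6.2–§6.5, on the half-chunk positions of a level-`ℓ` `ε`-interface tensor
`𝒯_{τ,L,ε}` (`ConstituentStageData.lean`):

* `ConstituentRegion` — the data: the level-`ℓ` term map `τ` and terms `L`, the input tolerance `ε`,
  the pair counts `k_X, k_Y, k_Z` (`= n_t γ̃_{W,t}`, §6.2), the `{α_t}` counts `cnt`, the level-`(ℓ−1)`
  split distributions `β_{W,t,i',j',k'}` and the buckets `B`;
* `ConstituentRegion.toHashed` — universe = the remaining level-`(ℓ−1)` triples
  (`tripleUniverse`), distinguished = the `{α_t}`-consistent ones, usefulness = Def. 6.11,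
  compatibility = Def. 6.9, ambient admitted sequences = those merging to level-1 blocks of the input
  (their complement inside `𝒯*` are the holes of the first type);
* `ConstituentRegion.wellFormed` — **the hypotheses of the abstract structure theorem hold**:
  closedness of the universe, useful ⇒ compatible (`IsUsefulFor₂.isCompatibleWith₂`) and
  **Claim 6.10** (`compatible_fst_of_useful₂`, under Remark 5.2's convention per term), given that the
  pair counts are supported on pairs summing to the level-`ℓ` indices;
* `usefulSub_eq_starTensor₂` — the useful sub-tensor over a triple of the universe IS `𝒯*`
  (`starTensor₂`, `mem_levelBlocksX/Y/Z_pair_iff`);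
* `summand_eq_brokenStar` — **the summand of the final tensor over a present triple `T` is `𝒯*_T` with
  the hole sets `firstTypeHolesX`, `firstTypeHolesY` and `firstTypeHolesZ ∪ holes T`** ("there will be
  two types of holes"), and `input_restrictsTo_directSum` — **the input `𝒯_{τ,L,ε}` (read on half-chunks)
  restricts to the direct sum of these broken copies over the present triples**.

Everything is proved; the definitions are `ConstituentRegion`, its `toHashed` and `WellFormed`; no
named facts.

## References

* V. Vassilevska Williams, Y. Xu, Z. Xu, R. Zhou, *New bounds for matrix multiplication: from alpha
  to omega*, SODA 2024, arXiv:2307.07970 (held: `paper:arxiv-2307.07970`), §6.2–§6.5 (the zero-outs,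
  Def. 6.9, Claim 6.10, Def. 6.11, `𝒯*`, the two types of holes). [VassilevskaWilliamsXuXuZhou2024]
-/

noncomputable section

open scoped BigOperators
open Finset

namespace Literature.Computability.AlgebraicComplexity

open Literature.Barriers.MatrixMultiplication (bigCwTensor)

universe u

/-- **The data of one region of the constituent stage.** [cite: VassilevskaWilliamsXuXuZhou2024, Prop. 6.2 (parameter list) and §6.2–§6.3] -/
structure ConstituentRegion (c n s M : ℕ) where
  /-- the level-`ℓ` term map -/
  τ : Fin n → Fin s
  /-- the level-`ℓ` terms of the input -/
  L : Fin s → InterfaceTerm (c + c)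
  /-- the tolerance of the input `ε`-interface tensor -/
  ε : ℝ
  /-- pair counts of the remaining `X`-blocks on each term (`n_t γ̃_{X,t}`) -/
  kX : Fin s → Fin (2 * c + 1) × Fin (2 * c + 1) → ℕ
  /-- pair counts of the remaining `Y`-blocks -/
  kY : Fin s → Fin (2 * c + 1) × Fin (2 * c + 1) → ℕ
  /-- pair counts of the remaining `Z`-blocks -/
  kZ : Fin s → Fin (2 * c + 1) × Fin (2 * c + 1) → ℕ
  /-- the `{α_t}` counts: `cnt t (i',j',k') = #left(t,(i',j',k'))` -/
  cnt : Fin s → ℕ × ℕ × ℕ → ℕ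
  /-- the level-`(ℓ−1)` `X`-split distributions `β_{X,t,i',j',k'}` -/
  βX : Fin s → ℕ × ℕ × ℕ → (Fin c → Fin 3) → ℝ
  /-- the level-`(ℓ−1)` `Y`-split distributions -/
  βY : Fin s → ℕ × ℕ × ℕ → (Fin c → Fin 3) → ℝ
  /-- the level-`(ℓ−1)` `Z`-split distributions -/
  βZ : Fin s → ℕ × ℕ × ℕ → (Fin c → Fin 3) → ℝ
  /-- the buckets -/
  B : Finset (ZMod M)

namespace ConstituentRegion

open scoped Classical

variable {c n s M : ℕ} (D : ConstituentRegion c n s M)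

/-- The universe of remaining level-`(ℓ−1)` block triples. [cite: VassilevskaWilliamsXuXuZhou2024, §6.2 (numtriple)] -/
abbrev tripleSet : Finset ((Fin (n + n) → Fin (2 * c + 1)) × (Fin (n + n) → Fin (2 * c + 1)) × (Fin (n + n) → Fin (2 * c + 1))) :=
  tripleUniverse D.τ D.kX D.kY D.kZ

/-- The `{α_t}`-consistent remaining triples. [cite: VassilevskaWilliamsXuXuZhou2024, §6.2 (numalpha)] -/
abbrev consistent : Finset ((Fin (n + n) → Fin (2 * c + 1)) × (Fin (n + n) → Fin (2 * c + 1)) × (Fin (n + n) → Fin (2 * c + 1))) :=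
  D.tripleSet.filter fun T => IsAlphaTConsistent D.τ D.cnt (seqVal T.1) (seqVal T.2.1) (seqVal T.2.2)

/-- The admitted level-1 `X`-sequences: those merging to a level-1 `X`-block of the input. [cite: VassilevskaWilliamsXuXuZhou2024, §6.5 (the first type of holes)] -/
def admX : Finset (Fin (n + n) → Fin c → Fin 3) := univ.filter fun Ih => mergeHalves Ih ∈ levelBlocksX D.τ D.L D.ε

/-- The admitted level-1 `Y`-sequences. [cite: VassilevskaWilliamsXuXuZhou2024, §6.5] -/
def admY : Finset (Fin (n + n) → Fin c → Fin 3) := univ.filter fun Jh => mergeHalves Jh ∈ levelBlocksY D.τ D.L D.ε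

/-- The admitted level-1 `Z`-sequences. [cite: VassilevskaWilliamsXuXuZhou2024, §6.5] -/
def admZ : Finset (Fin (n + n) → Fin c → Fin 3) := univ.filter fun Kh => mergeHalves Kh ∈ levelBlocksZ D.τ D.L D.ε

/-- Membership in the admitted `X`-sequences. [folklore] -/
@[simp] theorem mem_admX {Ih : Fin (n + n) → Fin c → Fin 3} : Ih ∈ D.admX ↔ mergeHalves Ih ∈ levelBlocksX D.τ D.L D.ε := by
  simp [admX]

/-- Membership in the admitted `Y`-sequences. [folklore] -/
@[simp] theorem mem_admY {Jh : Fin (n + n) → Fin c → Fin 3} : Jh ∈ D.admY ↔ mergeHalves Jh ∈ levelBlocksY D.τ D.L D.ε := by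
  simp [admY]

/-- Membership in the admitted `Z`-sequences. [folklore] -/
@[simp] theorem mem_admZ {Kh : Fin (n + n) → Fin c → Fin 3} : Kh ∈ D.admZ ↔ mergeHalves Kh ∈ levelBlocksZ D.τ D.L D.ε := by
  simp [admZ]

/-- **The constituent stage as a hashed stage**: universe, `{α_t}`-consistent triples, buckets, Def. 6.11
usefulness, Def. 6.9 compatibility, and the admitted sequences of the input. [cite: VassilevskaWilliamsXuXuZhou2024, §6.2–§6.5] -/
def toHashed : HashedZeroOut c (n + n) M where
  𝒯 := D.tripleSet
  𝒯α := D.consistent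
  B := D.B
  UX := fun T Ih => IsUsefulFor₂ D.τ D.βX (seqVal T.1) (seqVal T.2.1) (seqVal T.2.2) Ih
  UY := fun T Jh => IsUsefulFor₂ D.τ D.βY (seqVal T.1) (seqVal T.2.1) (seqVal T.2.2) Jh
  UZ := fun T Kh => IsUsefulFor₂ D.τ D.βZ (seqVal T.1) (seqVal T.2.1) (seqVal T.2.2) Kh
  CZ := fun T Kh => IsCompatibleWith₂ D.τ D.L (fun t ijk => (D.cnt t ijk : ℝ)) D.βZ (seqVal T.1) (seqVal T.2.1) (seqVal T.2.2) Kh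
  AX := D.admX
  AY := D.admY
  AZ := D.admZ

/-- The universe of the hashed stage. [folklore] -/
@[simp] theorem toHashed_𝒯 : D.toHashed.𝒯 = D.tripleSet := rfl

/-- The distinguished triples of the hashed stage. [folklore] -/
@[simp] theorem toHashed_𝒯α : D.toHashed.𝒯α = D.consistent := rfl

/-- The buckets of the hashed stage. [folklore] -/
@[simp] theorem toHashed_B : D.toHashed.B = D.B := rfl

/-- The admitted `X`-sequences of the hashed stage. [folklore] -/
@[simp] theorem toHashed_AX : D.toHashed.AX = D.admX := rfl

/-- The admitted `Y`-sequences of the hashed stage. [folklore] -/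
@[simp] theorem toHashed_AY : D.toHashed.AY = D.admY := rfl

/-- The admitted `Z`-sequences of the hashed stage. [folklore] -/
@[simp] theorem toHashed_AZ : D.toHashed.AZ = D.admZ := rfl

/-- The `Z`-usefulness of the hashed stage is Def. 6.11. [folklore] -/
theorem toHashed_UZ (T : (Fin (n + n) → Fin (2 * c + 1)) × (Fin (n + n) → Fin (2 * c + 1)) × (Fin (n + n) → Fin (2 * c + 1)))
    (Kh : Fin (n + n) → Fin c → Fin 3) :
    D.toHashed.UZ T Kh = IsUsefulFor₂ D.τ D.βZ (seqVal T.1) (seqVal T.2.1) (seqVal T.2.2) Kh := rfl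

/-- The compatibility of the hashed stage is Def. 6.9. [folklore] -/
theorem toHashed_CZ (T : (Fin (n + n) → Fin (2 * c + 1)) × (Fin (n + n) → Fin (2 * c + 1)) × (Fin (n + n) → Fin (2 * c + 1)))
    (Kh : Fin (n + n) → Fin c → Fin 3) :
    D.toHashed.CZ T Kh = IsCompatibleWith₂ D.τ D.L (fun t ijk => (D.cnt t ijk : ℝ)) D.βZ (seqVal T.1) (seqVal T.2.1) (seqVal T.2.2) Kh := rfl

/-- **The standing hypotheses on the data**: the pair counts are supported on pairs summing to the
level-`ℓ` indices of their term (so remaining blocks are inside the level-`ℓ` blocks), and the `Z`-data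
follows Remark 5.2's convention per term. [cite: VassilevskaWilliamsXuXuZhou2024, §6 (preamble) and Remark 5.2] -/
structure WellFormed : Prop where
  /-- `k_X` is supported on `l + r = i_t` -/
  suppX : ∀ t lr, D.kX t lr ≠ 0 → (lr.1 : ℕ) + lr.2 = (D.L t).i
  /-- `k_Y` is supported on `l + r = j_t` -/
  suppY : ∀ t lr, D.kY t lr ≠ 0 → (lr.1 : ℕ) + lr.2 = (D.L t).j
  /-- `k_Z` is supported on `l + r = k_t` -/
  suppZ : ∀ t lr, D.kZ t lr ≠ 0 → (lr.1 : ℕ) + lr.2 = (D.L t).k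
  /-- Remark 5.2: `β_{Z,t,i',0,k'}(L) = β_{X,t,i',0,k'}(2⃗ − L)` -/
  revX : ∀ t i k σ, D.βZ t (i, 0, k) σ = D.βX t (i, 0, k) (fun r => (σ r).rev)
  /-- Remark 5.2: `β_{Z,t,0,j',k'}(L) = β_{Y,t,0,j',k'}(2⃗ − L)` -/
  revY : ∀ t j k σ, D.βZ t (0, j, k) σ = D.βY t (0, j, k) (fun r => (σ r).rev)

variable {D}

/-- Triples of the universe are level triples inside the level-`ℓ` blocks. [cite: VassilevskaWilliamsXuXuZhou2024, §6.2] -/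
theorem tripleSet_good (hD : D.WellFormed)
    {T : (Fin (n + n) → Fin (2 * c + 1)) × (Fin (n + n) → Fin (2 * c + 1)) × (Fin (n + n) → Fin (2 * c + 1))}
    (hT : T ∈ D.tripleSet) :
    IsLevelTriple c (seqVal T.1) (seqVal T.2.1) (seqVal T.2.2) ∧ InsideX D.τ D.L T.1 ∧ InsideY D.τ D.L T.2.1 ∧ InsideZ D.τ D.L T.2.2 := by
  obtain ⟨⟨hX, hY, hZ⟩, -⟩ := mem_tripleUniverse.1 hT
  exact ⟨fun p => levelSum_of_mem_tripleUniverse hT p, insideX_of_mem_pairTypeClass D.τ D.L hD.suppX hX,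
    insideY_of_mem_pairTypeClass D.τ D.L hD.suppY hY, insideZ_of_mem_pairTypeClass D.τ D.L hD.suppZ hZ⟩

/-- Present triples are level triples (inside the level-`ℓ` blocks). [cite: VassilevskaWilliamsXuXuZhou2024, §6.2] -/
theorem present_isLevelTriple (hD : D.WellFormed) {ω : VxxzSeed M (n + n)} (T : ↥(D.toHashed.present ω)) :
    IsLevelTriple c (seqVal T.1.1) (seqVal T.1.2.1) (seqVal T.1.2.2) :=
  (tripleSet_good hD (filter_subset _ _ (presentTriples_subset T.2) : T.1 ∈ D.tripleSet)).1

/-- **The constituent stage satisfies the hypotheses of the abstract structure theorem.**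
[cite: VassilevskaWilliamsXuXuZhou2024, §6.3–§6.5 (Claim 6.10, Def. 6.9, Def. 6.11)] -/
theorem wellFormed (hD : D.WellFormed) : D.toHashed.WellFormed where
  subset := by
    show D.consistent ⊆ D.tripleSet
    exact filter_subset _ _
  closed := by
    intro T₁ hT₁ T₂ hT₂ T₃ hT₃ T₀ h1 h2 h3 hlev
    rw [toHashed] at hT₁ hT₂ hT₃ ⊢
    simp only at hT₁ hT₂ hT₃ ⊢
    rw [mem_tripleUniverse] at hT₁ hT₂ hT₃ ⊢
    refine ⟨⟨h1 ▸ hT₁.1.1, h2 ▸ hT₂.1.2.1, h3 ▸ hT₃.1.2.2⟩, fun p => hlev p⟩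
  usefulCompatible := by
    intro T hT Kh hu
    rw [toHashed] at hT ⊢
    simp only at hT hu ⊢
    obtain ⟨hTu, hcnt⟩ := mem_filter.1 hT
    obtain ⟨hlev, hI, hJ, hK⟩ := tripleSet_good hD hTu
    exact hu.isCompatibleWith₂ D.τ D.L hlev hI hJ hK hcnt
  claim59 := by
    intro Ih Jh Kh hsum hT₀ huX huY T₃ hT₃ h3 huZ
    rw [toHashed] at hT₀ hT₃ ⊢
    simp only at hT₀ hT₃ huX huY huZ ⊢
    refine ⟨fun t i j k hij hne => ?_, ?_⟩
    · have := compatible_fst_of_useful₂ D.τ hD.revX hD.revY hsum huX huY t i j k hij hne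
      exact this
    · -- typicality from the usefulness for `T₃ ∈ 𝒯α` through `Z_K`
      obtain ⟨hT₃u, hcnt⟩ := mem_filter.1 hT₃
      obtain ⟨hlev, hI, hJ, hK⟩ := tripleSet_good hD hT₃u
      have htyp := huZ.isTypical₂ D.τ D.L hlev hI hJ hK hcnt
      rw [h3] at htyp
      exact htyp

/-! ### The summands are broken copies of `𝒯*` -/

variable (R : Type u) [CommSemiring R] (q : ℕ)

/-- **The useful sub-tensor over a triple of the universe is `𝒯*`.** [cite: VassilevskaWilliamsXuXuZhou2024, §6.5 (𝒯*) and Claim 5.11] -/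
theorem usefulSub_eq_starTensor₂
    {T : (Fin (n + n) → Fin (2 * c + 1)) × (Fin (n + n) → Fin (2 * c + 1)) × (Fin (n + n) → Fin (2 * c + 1))}
    (h : IsLevelTriple c (seqVal T.1) (seqVal T.2.1) (seqVal T.2.2)) :
    D.toHashed.usefulSub R q T = starTensor₂ D.τ R q h D.βX D.βY D.βZ := by
  rw [HashedZeroOut.usefulSub, starTensor₂, interfaceTensor]
  congr 1
  · ext Ih
    rw [mem_filter, mem_levelBlocksX_pair_iff D.τ h, chunkLevels_eq_iff]
    simp [toHashed]
  · ext Jh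
    rw [mem_filter, mem_levelBlocksY_pair_iff D.τ h, chunkLevels_eq_iff]
    simp [toHashed]
  · ext Kh
    rw [mem_filter, mem_levelBlocksZ_pair_iff D.τ h, chunkLevels_eq_iff]
    simp [toHashed]

omit [CommSemiring R] in
/-- Zero-outs of a zero-out only depend on the traces of the block sets on its blocks. [folklore] -/
theorem partSubtensor_partSubtensor_congr {X Y Z PX PY PZ : Type*} [DecidableEq PX] [DecidableEq PY] [DecidableEq PZ]
    [CommSemiring R] (pX : X → PX) (pY : Y → PY) (pZ : Z → PZ) (T : X → Y → Z → R)
    (SX : Finset PX) (SY : Finset PY) (SZ : Finset PZ) {A A' : Finset PX} {B B' : Finset PY} {C C' : Finset PZ}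
    (hA : ∀ a ∈ SX, a ∈ A ↔ a ∈ A') (hB : ∀ b ∈ SY, b ∈ B ↔ b ∈ B') (hC : ∀ c ∈ SZ, c ∈ C ↔ c ∈ C') :
    partSubtensor pX pY pZ (partSubtensor pX pY pZ T SX SY SZ) A B C =
      partSubtensor pX pY pZ (partSubtensor pX pY pZ T SX SY SZ) A' B' C' := by
  rw [partSubtensor_partSubtensor, partSubtensor_partSubtensor]
  congr 1
  · ext a; simp only [mem_inter]; exact ⟨fun h => ⟨h.1, (hA a h.1).1 h.2⟩, fun h => ⟨h.1, (hA a h.1).2 h.2⟩⟩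
  · ext b; simp only [mem_inter]; exact ⟨fun h => ⟨h.1, (hB b h.1).1 h.2⟩, fun h => ⟨h.1, (hB b h.1).2 h.2⟩⟩
  · ext c'; simp only [mem_inter]; exact ⟨fun h => ⟨h.1, (hC c' h.1).1 h.2⟩, fun h => ⟨h.1, (hC c' h.1).2 h.2⟩⟩

/-- **The summand over a present triple is a broken copy of `𝒯*` with holes of both types**: `𝒯*_T`
with the level-1 `X`-blocks `firstTypeHolesX`, the `Y`-blocks `firstTypeHolesY`, and the `Z`-blocks
`firstTypeHolesZ ∪ holes T` (second type: compatible with another present triple) zeroed out.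
[cite: VassilevskaWilliamsXuXuZhou2024, §6.5 ("there will be two types of holes") and §6.6] -/
theorem summand_eq_brokenStar (hD : D.WellFormed) {ω : VxxzSeed M (n + n)} (T : ↥(D.toHashed.present ω))
    (h : IsLevelTriple c (seqVal T.1.1) (seqVal T.1.2.1) (seqVal T.1.2.2)) :
    D.toHashed.summand R q ω T =
      partSubtensor levelSeq levelSeq levelSeq (starTensor₂ D.τ R q h D.βX D.βY D.βZ)
        (firstTypeHolesX D.τ D.L D.ε h D.βX D.βY D.βZ)ᶜ (firstTypeHolesY D.τ D.L D.ε h D.βX D.βY D.βZ)ᶜ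
        (firstTypeHolesZ D.τ D.L D.ε h D.βX D.βY D.βZ ∪ D.toHashed.holes ω T.1)ᶜ := by
  rw [HashedZeroOut.summand_eq_brokenCopy (wellFormed hD) R q T, usefulSub_eq_starTensor₂ R q h, starTensor₂, interfaceTensor]
  refine partSubtensor_partSubtensor_congr R _ _ _ _ _ _ _ (fun Ih hIh => ?_) (fun Jh hJh => ?_) (fun Kh hKh => ?_)
  · simp only [toHashed, mem_admX, firstTypeHolesX, mem_compl, mem_filter, not_and, not_not]
    exact ⟨fun hm _ => hm, fun hm => hm hIh⟩
  · simp only [toHashed, mem_admY, firstTypeHolesY, mem_compl, mem_filter, not_and, not_not]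
    exact ⟨fun hm _ => hm, fun hm => hm hJh⟩
  · simp only [toHashed, mem_admZ, firstTypeHolesZ, mem_compl, mem_union, mem_sdiff, mem_filter, not_or, not_and, not_not]
    constructor
    · rintro ⟨hm, hnot⟩; exact ⟨fun _ => hm, hnot⟩
    · rintro ⟨hm, hnot⟩; exact ⟨hm hKh, hnot⟩

/-- **The input restricts to the final tensor of the stage** (all the zero-outs of §6.2–§6.5 applied to
the input read on half-chunks are zero-outs). [cite: VassilevskaWilliamsXuXuZhou2024, §6.2–§6.5] -/
theorem inputOnHalves_restrictsTo_finalTensor (ω : VxxzSeed M (n + n)) :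
    TensorRestrictsTo (inputOnHalves R q D.τ D.L D.ε) (D.toHashed.finalTensor R q ω) := by
  -- the final tensor keeps only admitted sequences, so it is a zero-out of the input on half-chunks
  have e : D.toHashed.finalTensor R q ω = partSubtensor levelSeq levelSeq levelSeq (inputOnHalves R q D.τ D.L D.ε)
      (univ.filter (D.toHashed.keepX ω)) (univ.filter (D.toHashed.keepY ω)) (univ.filter (D.toHashed.keepZ ω)) := by
    have hin : inputOnHalves R q D.τ D.L D.ε = partSubtensor levelSeq levelSeq levelSeq
        (kroneckerPow (kroneckerPow (bigCwTensor R q) c) (n + n)) D.admX D.admY D.admZ := by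
      funext x y z
      rw [inputOnHalves, interfaceTensor, partSubtensor_apply, partSubtensor_apply, kroneckerPow_bigCw_mergeHalves]
      simp only [mem_admX, mem_admY, mem_admZ, levelSeq_mergeHalves]
    rw [hin, partSubtensor_partSubtensor, HashedZeroOut.finalTensor]
    congr 1
    · ext Ih; simp only [mem_inter, mem_filter, mem_univ, true_and]
      exact ⟨fun hk => ⟨hk.1, hk⟩, fun hk => hk.2⟩
    · ext Jh; simp only [mem_inter, mem_filter, mem_univ, true_and]
      exact ⟨fun hk => ⟨hk.1, hk⟩, fun hk => hk.2⟩
    · ext Kh; simp only [mem_inter, mem_filter, mem_univ, true_and]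
      exact ⟨fun hk => ⟨hk.1, hk⟩, fun hk => hk.2⟩
  rw [e]
  exact tensorRestrictsTo_partSubtensor _ _ _ _ _ _ _

/-- **The input `ε`-interface tensor restricts to the direct sum, over the present triples, of the broken
copies of `𝒯*`.** [cite: VassilevskaWilliamsXuXuZhou2024, §6.5 ("Ideally, we want the subtensor of 𝒯''' over each triple X_I Y_J Z_K to be isomorphic to 𝒯*. However, there will be two types of holes")] -/
theorem input_restrictsTo_directSum (hD : D.WellFormed) (ω : VxxzSeed M (n + n)) :
    TensorRestrictsTo (interfaceTensor R q D.τ D.L D.ε)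
      (familyDirectSum fun T : ↥(D.toHashed.present ω) => D.toHashed.summand R q ω T) :=
  ((tensorRestrictsTo_inputOnHalves R q D.τ D.L D.ε).trans (inputOnHalves_restrictsTo_finalTensor R q ω)).trans
    (HashedZeroOut.finalTensor_restrictsTo_directSum (wellFormed hD) R q ω)

end ConstituentRegion

end Literature.Computability.AlgebraicComplexity
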